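import Literature.Algebra.Homology.TwistedCoinvariantsOrbitFactorsFormula
import HarnessLib

/-!
# Twisted coinvariants with product data: the orbit-factor isomorphism with CHOSEN base coordinates, and NATURALITY of the orbit factors under an
# equivariant map between two modules with product data (Brown II §2, III (5.3), (5.8), (6.2))

Topic `Algebra/Homology`; namespace `Literature.Algebra.Homology.InducedModule`, continuing `TwistedCoinvariantsOrbitFactors.lean` (★★★ `quotTwistRelEquivPiOrbitFactors`, base
coordinates `orbitBase` chosen by `Quotient.out`) and `TwistedCoinvariantsOrbitFactorsFormula.lean` (the value on a vector supported at any coordinate).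
* §1 `orbitSectionAt i₀` (a section of the fibre over ANY base point), ★★ **`quotTwistRelEquivPiOrbitFactorsAt i₀ : V ⧸ twistRel ≃ₗ Π_O A_{i₀ O} ⧸ factorTwistRel (i₀ O)`**
  for a CHOSEN family of base coordinates `i₀ O` in each orbit (S92's `quotTwistRelEquivPiOrbits` + `orbitFactorEquiv`), with `_mk_of_mem_of_smul_eq` (value on a vector supported
  at `φ(t)·i₀(O)`) and `_symm_single` — so that a consumer passing to an inverse limit along a tower can take the base coordinates COHERENTLY (one coherent prime `𝔓`);
* §2 ★★ **naturality on generators**: for a `Υ`-equivariant `f : V' → V` between modules with product data over possibly different groups and index sets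
  (`InducedModuleTwistedCoinvariants.coinvMapOfEquivariant`), `e_{i₀} (f_* (e'_{i₀'}⁻¹ (single_{O'} [a']))) = single_O (χ(t) • [π_{i₀ O} (φ(t)⁻¹ f ṽ')])` whenever the image
  `f ṽ'` of the lift of `a'` is supported at the coordinate `φ(t)·i₀(O)` (`quotTwistRelEquivPiOrbitFactorsAt_coinvMap_symm_single`) — block-compatible maps (the semi-local norm,
  supported-at-`w'` ↦ supported-at-`w' ∩ F_n`) are computed orbit factor by orbit factor.
Use (cell `bsd-print-cf2`, brick §4(c)/(e)): with `EllipticUnits/SemilocalUnitTowerNormPlaces` (the transition `normU` at a place = the local norm) this identifies the transition maps of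
`lim←_{(n,k)} tLayerCoinvEquivPiOrbits` as the local norms of the `𝔓`-tower.  Definitions with bodies (`orbitSectionAt`, `quotTwistRelEquivPiOrbitFactorsAt`) and theorems; no named fact,
no `sorry`, no instance.

## References
* [Brown1982CohomologyGroups] K. S. Brown, *Cohomology of Groups* (1982), II §2; III §5 Prop. (5.3), (5.4), (5.8); III §6 (6.2).
* [deShalit1987] E. de Shalit, *Iwasawa theory of elliptic curves with complex multiplication* (1987), III §1.3–1.4.
-/

noncomputable section

universe u

namespace Literature.Algebra.Homology

namespace InducedModule

open Representation DirectSum CoinducedModule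

variable {k G : Type u} [CommRing k] [Group G] {V : Type u} [AddCommGroup V] [Module k V]
  (N : Representation k G V) {Υ : Type u} [Group Υ] (φ : Υ →* G) (χ : Υ →* kˣ)
  {I : Type u} [MulAction G I] {A : I → Type u} [∀ i, AddCommGroup (A i)] [∀ i, Module k (A i)] (π : ∀ i, V →ₗ[k] A i)
  (hker : ∀ (g : G) (i : I), LinearMap.ker (π (g • i) ∘ₗ N g) = LinearMap.ker (π i))
  (hbij : Function.Bijective (LinearMap.pi π))

/-! ## §1. Chosen base coordinates -/

/-- Every point of the fibre is a translate of ANY given base point. [cite: Brown1982CohomologyGroups, III §5 Prop. (5.3)] -/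
theorem exists_smul_eq_of_orbitLabel_eq (c : Quotient (orbitSetoid φ (I := I))) (i₀ i : {i // orbitLabel φ i = c}) : ∃ u : Υ, φ u • (i₀ : I) = i :=
  Quotient.exact (i₀.2.trans i.2.symm)

/-- **A section of the fibre over a chosen base point `i₀`** (`φ (s i) • i₀ = i`). [cite: Brown1982CohomologyGroups, III §5 Prop. (5.3)] -/
def orbitSectionAt (c : Quotient (orbitSetoid φ (I := I))) (i₀ : {i // orbitLabel φ i = c}) (i : {i // orbitLabel φ i = c}) : Υ :=
  (exists_smul_eq_of_orbitLabel_eq φ c i₀ i).choose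

/-- The defining property of `orbitSectionAt`. [cite: Brown1982CohomologyGroups, III §5 Prop. (5.3)] -/
theorem orbitSectionAt_smul (c : Quotient (orbitSetoid φ (I := I))) (i₀ : {i // orbitLabel φ i = c}) (i : {i // orbitLabel φ i = c}) :
    φ (orbitSectionAt φ c i₀ i) • (i₀ : I) = i :=
  (exists_smul_eq_of_orbitLabel_eq φ c i₀ i).choose_spec

variable [DecidableEq I] [Fintype I] [Fintype (Quotient (orbitSetoid φ (I := I)))] [DecidableEq (Quotient (orbitSetoid φ (I := I)))]
  (i₀ : ∀ c : Quotient (orbitSetoid φ (I := I)), {i // orbitLabel φ i = c})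

/-- ★★ **`V_{Υ,χ} ≅ Π_O A_{i₀(O)} ⧸ factorTwistRel (i₀ O)` for CHOSEN base coordinates `i₀ O`** (one per orbit; e.g. the places of a coherent prime `𝔓` along a tower).
[cite: Brown1982CohomologyGroups, II §2; III §5 Prop. (5.3), (5.8); III §6 (6.2)] -/
def quotTwistRelEquivPiOrbitFactorsAt :
    (V ⧸ twistRel N φ χ) ≃ₗ[k] Π c : Quotient (orbitSetoid φ (I := I)), (A ((i₀ c : {i // orbitLabel φ i = c}) : I) ⧸ factorTwistRel N φ χ π hker hbij ((i₀ c : {i // orbitLabel φ i = c}) : I)) :=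
  (quotTwistRelEquivPiOrbits N φ χ (coordSummand π) (coordSummand_map_le N π hker) (orbitLabel φ) (orbitLabel_smul φ) (isInternal_coordSummand π hbij) i₀
      (fun c => orbitSectionAt φ c (i₀ c)) (fun c => orbitSectionAt_smul φ c (i₀ c))).trans
    (LinearEquiv.piCongrRight fun c => orbitFactorEquiv N φ χ π hker hbij c (i₀ c))

/-- **On a vector supported at the chosen base coordinate**: `v ∈ M_{i₀(O)} ↦ single_O [π v]`. [cite: Brown1982CohomologyGroups, III §6 (6.2)] -/
theorem quotTwistRelEquivPiOrbitFactorsAt_mk_of_mem (c : Quotient (orbitSetoid φ (I := I))) {v : V}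
    (hv : v ∈ coordSummand π ((i₀ c : {i // orbitLabel φ i = c}) : I)) :
    quotTwistRelEquivPiOrbitFactorsAt N φ χ π hker hbij i₀ (Submodule.Quotient.mk v) =
      Pi.single c (Submodule.Quotient.mk (π ((i₀ c : {i // orbitLabel φ i = c}) : I) v)) := by
  have hvb : v ∈ block (coordSummand π) (orbitLabel φ) c :=
    (le_block (coordSummand π) (orbitLabel φ) _).trans_eq (congrArg (block (coordSummand π) (orbitLabel φ)) (i₀ c).2) hv
  have hvs : (⟨v, hvb⟩ : ↥(block (coordSummand π) (orbitLabel φ) c)) ∈ blockSummand (coordSummand π) (orbitLabel φ) c (i₀ c) := hv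
  rw [quotTwistRelEquivPiOrbitFactorsAt, LinearEquiv.trans_apply, quotTwistRelEquivPiOrbits, LinearEquiv.trans_apply, quotTwistRelEquivPiBlock,
    quotTwistRelEquivPiOfIsInternal_mk_of_mem N φ χ _ _ _ hvb]
  funext c'
  rw [LinearEquiv.piCongrRight_apply, LinearEquiv.piCongrRight_apply]
  by_cases h : c' = c
  · subst h
    rw [Pi.single_eq_same, Pi.single_eq_same, blockShapiroEquiv_symm_mk_of_mem N φ χ (hm := hvs)]
    rfl
  · rw [Pi.single_eq_of_ne h, Pi.single_eq_of_ne h, map_zero, map_zero]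

/-- ★★ **On a vector supported at ANY coordinate**: `v ∈ M_i`, `φ(t)·i₀(O) = i` ⟹ `e [v] = single_O (χ(t) • [π_{i₀(O)} (φ(t)⁻¹ v)])`.
[cite: Brown1982CohomologyGroups, III §5 Prop. (5.3); III §6 (6.2)] [cite: deShalit1987, III §1.3–1.4] -/
theorem quotTwistRelEquivPiOrbitFactorsAt_mk_of_mem_of_smul_eq (c : Quotient (orbitSetoid φ (I := I))) {i : I} {v : V} (hv : v ∈ coordSummand π i)
    (t : Υ) (ht : φ t • ((i₀ c : {i // orbitLabel φ i = c}) : I) = i) :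
    quotTwistRelEquivPiOrbitFactorsAt N φ χ π hker hbij i₀ (Submodule.Quotient.mk v) =
      Pi.single c (((χ t : kˣ) : k) • Submodule.Quotient.mk (π ((i₀ c : {i // orbitLabel φ i = c}) : I) (N (φ t)⁻¹ v))) := by
  have h1 : (Submodule.Quotient.mk v : V ⧸ twistRel N φ χ) = ((χ t : kˣ) : k) • Submodule.Quotient.mk (N (φ t)⁻¹ v) :=
    mkQ_eq_smul_mkQ_apply_inv N φ χ t v
  rw [h1, map_smul, quotTwistRelEquivPiOrbitFactorsAt_mk_of_mem N φ χ π hker hbij i₀ c (apply_inv_mem_coordSummand_of_smul_eq N φ π hker hv t ht),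
    Pi.single_smul]

/-- **The inverse on one factor**: `single_O [a] ↦ [ṽ]`, `ṽ ∈ M_{i₀(O)}` the lift of `a`. [cite: Brown1982CohomologyGroups, III §6 (6.2)] -/
theorem quotTwistRelEquivPiOrbitFactorsAt_symm_single (c : Quotient (orbitSetoid φ (I := I))) (a : A ((i₀ c : {i // orbitLabel φ i = c}) : I)) :
    (quotTwistRelEquivPiOrbitFactorsAt N φ χ π hker hbij i₀).symm (Pi.single c (Submodule.Quotient.mk a)) =
      Submodule.Quotient.mk ((coordSummandEquiv π hbij ((i₀ c : {i // orbitLabel φ i = c}) : I)).symm a : V) := by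
  rw [LinearEquiv.symm_apply_eq, quotTwistRelEquivPiOrbitFactorsAt_mk_of_mem N φ χ π hker hbij i₀ c ((coordSummandEquiv π hbij _).symm a).2,
    pi_coordSummandEquiv_symm_apply]

/-! ## §2. Naturality on generators under an equivariant map between two modules with product data -/

section Naturality

variable {G' : Type u} [Group G'] {V' : Type u} [AddCommGroup V'] [Module k V'] (N' : Representation k G' V') (φ' : Υ →* G')
  {I' : Type u} [MulAction G' I'] {A' : I' → Type u} [∀ i', AddCommGroup (A' i')] [∀ i', Module k (A' i')] (π' : ∀ i', V' →ₗ[k] A' i')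
  (hker' : ∀ (g : G') (i' : I'), LinearMap.ker (π' (g • i') ∘ₗ N' g) = LinearMap.ker (π' i'))
  (hbij' : Function.Bijective (LinearMap.pi π'))
  [DecidableEq I'] [Fintype I'] [Fintype (Quotient (orbitSetoid φ' (I := I')))] [DecidableEq (Quotient (orbitSetoid φ' (I := I')))]
  (i₀' : ∀ c' : Quotient (orbitSetoid φ' (I := I')), {i' // orbitLabel φ' i' = c'})
  (f : V' →ₗ[k] V) (hf : ∀ u : Υ, f ∘ₗ N' (φ' u) = N (φ u) ∘ₗ f)

/-- ★★ **NATURALITY OF THE ORBIT FACTORS ON GENERATORS**: for a `Υ`-equivariant `f : V' → V` and `a'` in the factor of the orbit `O'` (base coordinate `i₀'(O')`, lift `ṽ'`), if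
`f ṽ'` is supported at the coordinate `i = φ(t)·i₀(O)` of `V` (block compatibility), then
`e (f_* (e'⁻¹ (single_{O'} [a']))) = single_O (χ(t) • [π_{i₀(O)} (φ(t)⁻¹ (f ṽ'))])` — the map of `χ`-coinvariants induced by `f` is computed orbit factor by orbit factor.
[cite: Brown1982CohomologyGroups, II §2; III §5 Prop. (5.3); III §6 (6.2)] [cite: deShalit1987, III §1.3–1.4] -/
theorem quotTwistRelEquivPiOrbitFactorsAt_coinvMap_symm_single (c' : Quotient (orbitSetoid φ' (I := I')))
    (a' : A' ((i₀' c' : {i' // orbitLabel φ' i' = c'}) : I')) (c : Quotient (orbitSetoid φ (I := I))) {i : I}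
    (hfi : f ((coordSummandEquiv π' hbij' ((i₀' c' : {i' // orbitLabel φ' i' = c'}) : I')).symm a' : V') ∈ coordSummand π i)
    (t : Υ) (ht : φ t • ((i₀ c : {i // orbitLabel φ i = c}) : I) = i) :
    quotTwistRelEquivPiOrbitFactorsAt N φ χ π hker hbij i₀
        (coinvMapOfEquivariant N φ χ N' φ' f hf
          ((quotTwistRelEquivPiOrbitFactorsAt N' φ' χ π' hker' hbij' i₀').symm (Pi.single c' (Submodule.Quotient.mk a')))) =
      Pi.single c (((χ t : kˣ) : k) • Submodule.Quotient.mk (π ((i₀ c : {i // orbitLabel φ i = c}) : I)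
        (N (φ t)⁻¹ (f ((coordSummandEquiv π' hbij' ((i₀' c' : {i' // orbitLabel φ' i' = c'}) : I')).symm a' : V'))))) := by
  rw [quotTwistRelEquivPiOrbitFactorsAt_symm_single, coinvMapOfEquivariant_mk,
    quotTwistRelEquivPiOrbitFactorsAt_mk_of_mem_of_smul_eq N φ χ π hker hbij i₀ c hfi t ht]

end Naturality

end InducedModule

end Literature.Algebra.Homology

end
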